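import Summits.Ventures.PercRepro.Night2ThreeTwoBasisCell
import Summits.Ventures.PercRepro.Night2GeneralQPoly

/-!
# PercRepro — the quadratic count sum of the `(3, 2)` obstruction cell: the tail `n ≥ 31` (night-2, gen 25)

`qSum L y i₀ j₀ n ≥ (n + 56)/(20 n)` for `n ≥ 31`, `3 ≤ y ≤ 6`, `y ≤ n − 8`, the profiles `i₀ ≤ 2`, `i₀ + j₀ = 4`,
`j₀ ≤ y`, `L = n − y`: the single term `(i, j) = (i₀ + ⌊k/2⌋, y)`, `k = L − i₀ ≥ n − 8`, has
`C(k, ⌊k/2⌋) ≥ 2^k/(k + 1)`, a floor `≥ 1/60` and `lineCount ≤ 20 n²`, and `60 · n² · (n + 56) ≤ 2^{n−8}` (from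
`990 · n² · (n + 56) ≤ 13 · 2^{n−8}`, `n ≥ 31`, by induction).  With the kernel range `13 ≤ n ≤ 30` (a generator job) this closes the arithmetic of
`localShadowHall_three_two_five_of_qSums` (proofs/NIGHT-2-g25.md §6).

* `lineCount_le`: `lineCount i j ≤ 20 n²` for `i + j ≤ n`, `j ≤ 6`;
* `thirteen_two_pow_ge`: `990 · n² · (n + 56) ≤ 13 · 2^{n−8}` for `n ≥ 31`;
* **`E_le_qSum_of_tail`**: the tail inequality.
-/

namespace PercRepro.Shadow

open Finset

/-- `lineCount i j ≤ 20 n²` when `i + j ≤ n`, `j ≤ 6` and `n ≥ 5`. -/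
theorem lineCount_le {i j n : ℕ} (hij : i + j ≤ n) (hj : j ≤ 6) (hn : 5 ≤ n) : lineCount i j ≤ 20 * n ^ 2 := by
  unfold lineCount
  have h1 : i.choose 2 ≤ n ^ 2 := by
    calc i.choose 2 ≤ i ^ 2 := by
          rw [Nat.choose_two_right]
          have : i * (i - 1) ≤ i * i := Nat.mul_le_mul_left i (Nat.sub_le i 1)
          calc i * (i - 1) / 2 ≤ i * (i - 1) := Nat.div_le_self _ _
            _ ≤ i * i := this
            _ = i ^ 2 := by ring
      _ ≤ n ^ 2 := Nat.pow_le_pow_left (by omega) 2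
  have h2 : j.choose 2 ≤ 15 := (Nat.choose_le_choose 2 hj).trans (by decide)
  have h3 : j.choose 3 ≤ 20 := (Nat.choose_le_choose 3 hj).trans (by decide)
  have h4 : j.choose 4 ≤ 15 := (Nat.choose_le_choose 4 hj).trans (by decide)
  have h5 : i ≤ n := by omega
  have h6 : 20 * n + 15 ≤ 5 * n ^ 2 := by nlinarith
  have h7 : i.choose 2 * j.choose 2 ≤ n ^ 2 * 15 := Nat.mul_le_mul h1 h2
  have h8 : i * j.choose 3 ≤ n * 20 := Nat.mul_le_mul h5 h3
  nlinarith

/-- `990 · (m + 31)² · (m + 87) ≤ 13 · 2^{m+23}` (induction on `m`). -/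
theorem thirteen_two_pow_ge_aux (m : ℕ) : 990 * (m + 31) ^ 2 * (m + 87) ≤ 13 * 2 ^ (m + 23) := by
  induction m with
  | zero => norm_num
  | succ m ih =>
    have key : 990 * (m + 1 + 31) ^ 2 * (m + 1 + 87) ≤ 2 * (990 * (m + 31) ^ 2 * (m + 87)) := by
      have e2 : 2 * (990 * (m + 31) ^ 2 * (m + 87)) =
          990 * (m + 1 + 31) ^ 2 * (m + 1 + 87) + 990 * (m ^ 3 + 146 * m ^ 2 + 6054 * m + 77102) := by ring
      rw [e2]
      exact Nat.le_add_right _ _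
    calc 990 * (m + 1 + 31) ^ 2 * (m + 1 + 87) ≤ 2 * (990 * (m + 31) ^ 2 * (m + 87)) := key
      _ ≤ 2 * (13 * 2 ^ (m + 23)) := Nat.mul_le_mul_left 2 ih
      _ = 13 * 2 ^ (m + 1 + 23) := by ring

/-- `990 · n² · (n + 56) ≤ 13 · 2^{n−8}` for `n ≥ 31`. -/
theorem thirteen_two_pow_ge (n : ℕ) (hn : 31 ≤ n) : 990 * n ^ 2 * (n + 56) ≤ 13 * 2 ^ (n - 8) := by
  obtain ⟨m, rfl⟩ : ∃ m, n = m + 31 := ⟨n - 31, by omega⟩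
  have e : m + 31 - 8 = m + 23 := by omega
  rw [e]
  calc 990 * (m + 31) ^ 2 * (m + 31 + 56) = 990 * (m + 31) ^ 2 * (m + 87) := by ring
    _ ≤ _ := thirteen_two_pow_ge_aux m

/-- The single term of `qSum` at `(i₀ + ⌊k/2⌋, y)`. -/
theorem qSum_ge_term (L y i₀ j₀ n : ℕ) (hi₀ : i₀ ≤ L) (hj₀ : j₀ ≤ y) (hy : 3 ≤ y)
    (hne : (i₀ + (L - i₀) / 2, y) ≠ (i₀, j₀)) :
    (((L - i₀).choose ((L - i₀) / 2) : ℚ)) * cFloor n (i₀ + (L - i₀) / 2 + y) /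
        (lineCount (i₀ + (L - i₀) / 2) y : ℚ) ≤ qSum L y i₀ j₀ n := by
  unfold qSum
  have hi : i₀ + (L - i₀) / 2 ∈ Finset.range (L + 1) := by
    rw [Finset.mem_range]; omega
  have hy' : y ∈ Finset.range (y + 1) := by rw [Finset.mem_range]; omega
  have hterm : ∀ i ∈ Finset.range (L + 1), 0 ≤ ∑ j ∈ Finset.range (y + 1),
      (if 3 ≤ j ∧ i₀ ≤ i ∧ j₀ ≤ j ∧ (i, j) ≠ (i₀, j₀) then
        ((L - i₀).choose (i - i₀) * (y - j₀).choose (j - j₀) : ℚ) * cFloor n (i + j) / (lineCount i j : ℚ)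
      else 0) := by
    intro i _
    apply Finset.sum_nonneg
    intro j _
    split_ifs
    · exact qSum_term_nonneg L y i₀ j₀ n i j
    · exact le_refl _
  refine le_trans ?_ (Finset.single_le_sum hterm hi)
  have hterm' : ∀ j ∈ Finset.range (y + 1), 0 ≤
      (if 3 ≤ j ∧ i₀ ≤ i₀ + (L - i₀) / 2 ∧ j₀ ≤ j ∧ (i₀ + (L - i₀) / 2, j) ≠ (i₀, j₀) then
        ((L - i₀).choose (i₀ + (L - i₀) / 2 - i₀) * (y - j₀).choose (j - j₀) : ℚ) *
          cFloor n (i₀ + (L - i₀) / 2 + j) / (lineCount (i₀ + (L - i₀) / 2) j : ℚ)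
      else 0) := by
    intro j _
    split_ifs
    · exact qSum_term_nonneg L y i₀ j₀ n _ j
    · exact le_refl _
  refine le_trans ?_ (Finset.single_le_sum hterm' hy')
  rw [if_pos ⟨hy, by omega, hj₀, hne⟩, Nat.choose_self, Nat.add_sub_cancel_left]
  push_cast
  rw [mul_one]

/-- **The tail of the quadratic count sum**: for `n ≥ 31`, `3 ≤ y ≤ 6`, `y + 8 ≤ n`, and a basis profile (`i₀ ≤ 2`,
`i₀ + j₀ = 4`, `j₀ ≤ y`), `(n + 56)/(20 n) ≤ qSum (n − y) y i₀ j₀ n`. -/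
theorem E_le_qSum_of_tail (n y i₀ j₀ : ℕ) (hn : 31 ≤ n) (hy3 : 3 ≤ y) (hy6 : y ≤ 6) (hyn : y + 8 ≤ n)
    (hi₀ : i₀ ≤ 2) (hij : i₀ + j₀ = 4) (hj₀ : j₀ ≤ y) :
    ((n : ℚ) + 56) / (20 * (n : ℚ)) ≤ qSum (n - y) y i₀ j₀ n := by
  set L := n - y with hL
  set k := L - i₀ with hk
  have hkn : n - 8 ≤ k := by omega
  have hne : (i₀ + k / 2, y) ≠ (i₀, j₀) := by
    intro h
    rw [Prod.mk.injEq] at h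
    -- `k/2 ≥ 1` since `k ≥ 23`
    omega
  have hterm := qSum_ge_term L y i₀ j₀ n (by omega) hj₀ hy3 (by rw [← hk]; exact hne)
  rw [← hk] at hterm
  refine le_trans ?_ hterm
  -- the three factors
  have hchoose : (2 : ℚ) ^ k / ((k : ℚ) + 1) ≤ (k.choose (k / 2) : ℚ) := by
    rw [div_le_iff₀ (by positivity)]
    have := two_pow_le_succ_mul_choose_middle k
    have h' : (2 : ℚ) ^ k ≤ ((k : ℚ) + 1) * (k.choose (k / 2) : ℚ) := by exact_mod_cast this
    linarith
  have hfloor : (1 / 60 : ℚ) ≤ cFloor n (i₀ + k / 2 + y) := by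
    unfold cFloor; split_ifs <;> norm_num
  have hlc : (lineCount (i₀ + k / 2) y : ℚ) ≤ 20 * (n : ℚ) ^ 2 := by
    have := lineCount_le (i := i₀ + k / 2) (j := y) (n := n) (by omega) hy6 (by omega)
    exact_mod_cast this
  have hlcpos : (0 : ℚ) < (lineCount (i₀ + k / 2) y : ℚ) := by
    have : 0 < lineCount (i₀ + k / 2) y := by
      unfold lineCount
      have : 1 ≤ y.choose 3 := Nat.succ_le_of_lt (Nat.choose_pos hy3)
      have : 1 ≤ i₀ + k / 2 := by omega
      nlinarith
    exact_mod_cast this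
  have hnpos : (0 : ℚ) < (n : ℚ) := by exact_mod_cast (by omega : 0 < n)
  -- the pure inequality `990 (k + 1) n (n + 56) ≤ 13 · 2^k`
  have hnat : 990 * (k + 1) * n * (n + 56) ≤ 13 * 2 ^ k := by
    have hk1 : k + 1 ≤ n := by omega
    calc 990 * (k + 1) * n * (n + 56) ≤ 990 * n * n * (n + 56) := by
          apply Nat.mul_le_mul_right
          apply Nat.mul_le_mul_right
          exact Nat.mul_le_mul_left _ hk1
      _ = 990 * n ^ 2 * (n + 56) := by ring
      _ ≤ 13 * 2 ^ (n - 8) := thirteen_two_pow_ge n hn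
      _ ≤ 13 * 2 ^ k := Nat.mul_le_mul_left _ (Nat.pow_le_pow_right (by norm_num) hkn)
  have hnatq : (990 : ℚ) * ((k : ℚ) + 1) * (n : ℚ) * ((n : ℚ) + 56) ≤ 13 * (2 : ℚ) ^ k := by
    have := (Nat.cast_le (α := ℚ)).2 hnat
    push_cast at this
    linarith
  have hk1pos : (0 : ℚ) < (k : ℚ) + 1 := by positivity
  have hnatq' : (60 : ℚ) * ((k : ℚ) + 1) * (n : ℚ) * ((n : ℚ) + 56) ≤ (2 : ℚ) ^ k := by
    have h2 : (0 : ℚ) ≤ (2 : ℚ) ^ k := by positivity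
    nlinarith [hnatq, h2]
  have hstep1 : ((n : ℚ) + 56) / (20 * (n : ℚ)) ≤
      ((2 : ℚ) ^ k / ((k : ℚ) + 1)) * (1 / 60) / (20 * (n : ℚ) ^ 2) := by
    have e : ((2 : ℚ) ^ k / ((k : ℚ) + 1)) * (1 / 60) / (20 * (n : ℚ) ^ 2) =
        ((2 : ℚ) ^ k) / (60 * ((k : ℚ) + 1) * 20 * (n : ℚ) ^ 2) := by
      field_simp
    rw [e, div_le_iff₀ (by positivity), div_mul_eq_mul_div, le_div_iff₀ (by positivity)]
    nlinarith [hnatq', hnpos]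
  refine hstep1.trans ?_
  calc ((2 : ℚ) ^ k / ((k : ℚ) + 1)) * (1 / 60) / (20 * (n : ℚ) ^ 2)
      ≤ (k.choose (k / 2) : ℚ) * cFloor n (i₀ + k / 2 + y) / (20 * (n : ℚ) ^ 2) := by
        apply div_le_div_of_nonneg_right _ (by positivity)
        exact mul_le_mul hchoose hfloor (by norm_num) (by positivity)
    _ ≤ (k.choose (k / 2) : ℚ) * cFloor n (i₀ + k / 2 + y) / (lineCount (i₀ + k / 2) y : ℚ) := by
        apply div_le_div_of_nonneg_left (mul_nonneg (by positivity) (cFloor_nonneg _ _)) hlcpos hlc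

end PercRepro.Shadow
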